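import Summits.HodgeConjecture.HodgeConjecture.Theorems.Ring2AbelianAllAndrePrimitiveLiftRows
import Summits.HodgeConjecture.HodgeConjecture.Theorems.Ring2AbelianAllAndreHodgeLatticeTotal
import HarnessLib

/-!
# Ring 2 · sub-cell AbelianAll (ALL ABELIAN VARIETIES), André axis, part XXI-d — THE PRIMITIVE LIFT READ ON THE TOTAL
# SPACE: at a fibre satisfying HC (a CM fibre under `HC_CM`), (Prim)_t(r) IS "every class of `span_ℂ Hdg^r(𝒳)` whose
# restriction to `X_t` is `κ`-PRIMITIVE lies in `N^r(𝒳) + ker j_t^*`" — the `B_min` class of record (F_CM, part VII; under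
# `HC_CM` ≡ Num^CM ≡ (L)) RE-READ as the Hodge conjecture for a finite-dimensional space of explicit Hodge classes of the
# `(d+1)`-dimensional total spaces (the fibre-primitive ones; a basis suffices), modulo the classes dying on the
# CM fibre; `d = 4`: (Num_t)(2,2) ⟺ that statement for the rational `(2,2)`-classes of ONE fivefold

HONEST FRAMING (page 1, verbatim): **research route, not a corollary; conditional on HC_CM plus one named
minimal statement.** Cell line: research route conditional on HC_CM; not a corollary; Q11.4-sentence-2
already refuted in dim ≥ 3. Nothing in this file proves a case of the Hodge conjecture for an abelian variety.
`HC_CM` = `Theses.RankFourFaces.CMAbelianHodge` is a BINDER wherever it occurs; `HC_AV` =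
`Theses.PadicSemiregularLift.HodgeAbelianVarieties`; `h₂₁` = `Andre1996.andre1996_cmAnchoredPencil`, `Verdier` =
`Motives.Verdier1976_genericLocalTriviality` (Literature named facts, BINDERS); item `Theses.RankFourFaces.CMToAbelian`
(stmt-16267) OPEN and not closed here. Seat `pub-hodge-ring2-ab-andre-2`, gen 13 (sequel of parts XXI-a/b/c; brief (iii)
"smallest open instance stated as a find-the-cycle problem").

## Content (notation of parts XXI-a/b; `Hdg^r(𝒳)` = rational `(r,r)`-classes of the total space, `span_ℂ` their span)

Part XVIII-f proved, on the carriers and unconditionally, Deligne's Hodge lift in lattice form: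
`(j_t^*)⁻¹(span Hdg^r(X_t)) = span Hdg^r(𝒳) ⊔ ker j_t^*` (`comap_hodgeSpan_map_fiberι_eq_span_hodge_sup_ker`), and read the
lift node as "(L) ⟺ ALL Hodge classes of the total space algebraic modulo `ker j_t^*`" under `HC_CM`. The primitive reduction
of part XXI keeps only the FIBRE-PRIMITIVE ones:

* §1 **`primitiveLift_of_span_hodge_primitive_le_sup`** (every pencil, every point, NO Hodge hypothesis): if every
  `W ∈ span Hdg^r(𝒳)` with `j_t^*W` `κ`-primitive lies in `N^r(𝒳) ⊔ ker j_t^*`, then (Prim)_t(r);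
  **`span_hodge_primitive_le_sup_of_primitiveLift_of_hodge`** (converse at a fibre with `HC^r`);
  **`primitiveLift_iff_span_hodge_primitive_le_sup_of_hodge` / `_of_HC_CM`** (the equivalence).
* §2 `d = 4`: **`numerical_two_two_iff_span_hodge_primitive_le_sup_of_HC_CM`** — at a CM point of a compact pencil of abelian
  FOURFOLDS, under `HC_CM`: (Num_t)(2,2) ⟺ [the fibre-primitive classes of `span Hdg²(𝒳)` on the FIVEFOLD are algebraic
  mod `ker j_t^*`]; node level with the display-only bracket `CMPrimitiveHodgeTotal[]` (NO def):
  `cmPrimitiveLift_of_cmPrimitiveHodgeTotal` (fact-free), `cmPrimitiveLift_iff_cmPrimitiveHodgeTotal_of_HC_CM`,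
  **`cmFibreAlgebraicLift_iff_cmPrimitiveHodgeTotal_of_HC_CM`** ((L) ⟺ bracket under `HC_CM`), the cell row
  **`HC_AV_of_HC_CM_of_cmPrimitiveHodgeTotal (h₂₁) (hCM)`**, on-path `cmPrimitiveHodgeTotal_of_hodgeConjecture`, exactness
  **`HC_AV_iff_HC_CM_and_cmPrimitiveHodgeTotal_of_verdier (h₂₁) (hGT)`**.

THE FIND-THE-CYCLE PROBLEM, FINAL FORM OF THIS GENERATION (`d = 4`): let `𝒳⁵ → S` be a CM-pointed compact pencil of abelian
fourfolds, `t` its CM point, `K` a global algebraic polarising class. For each rational `(2,2)`-class `W` of the fivefold `𝒳`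
whose restriction to the CM fourfold `X_t` is `κ`-primitive, find a codimension-2 cycle `Z` on `𝒳` with `[Z]|_{X_t} = W|_{X_t}`.
Under `HC_CM` (binder) this is exactly (Num_t)(2,2), the smallest kernel-open instance of `Num^CM` (in print `d = 4` is covered
at every point modulo Moonen–Zarhin 1999 + Markman's arXiv:2502.03415, part XX-b; the first instance open in print is `d = 6`,
where the list is: fibre-primitive Hodge classes of degrees 4 and 6 on the sevenfold).

HONEST STATUS: equivalent under `HC_CM` to Num^CM / (L) / (4) / (2) / F_CM (parts XIX–XXI), not weaker; nothing fact-free on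
`HC_AV`; 'minimal' claimed nowhere. EDGE LABELS (RING2-MAP §AbelianAll gen 13): §1 first theorem K, the iff K[HC^r(X_t)] /
K[HC_CM]; §2 K[HC_CM], HC_AV row K[h₂₁, HC_CM], iff K[h₂₁, Verdier], on-path K. References: DeligneHodgeII1971 (Thm. 4.1.1,
Cor. 4.1.2); VoisinHodgeII2003 (Thm. 4.18); Kleiman1968AlgebraicCycles (§3); Andre1996Motifs (Lemme 6.3.1, §6.3);
Milne2020HodgeClassesAV (Prop. 1); Verdier1976 (Cor. 5.1); MoonenZarhin1999LowDim; Markman2025SecantWeil (preprint).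
-/

noncomputable section

set_option linter.dupNamespace false

namespace Summit.HodgeConjecture.HodgeConjecture.Ring2.AbelianAll

open CategoryTheory AlgebraicGeometry
open Literature.AlgebraicGeometry Literature.AlgebraicGeometry.Motives
open Literature.AlgebraicGeometry.HodgeTheory
open Literature.AlgebraicTopology.SingularHomology (singularCohomology cupProduct)
open Literature.Geometry.Kaehler (lefschetzOperator lefschetzPow HasHardLefschetzProperty)
open Literature.AlgebraicGeometry.Deligne1982 (cmLocus)
open Literature.AlgebraicGeometry.Andre1996 (andre1996_cmAnchoredPencil)
open Summit.HodgeConjecture.HodgeConjecture.Theses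

variable {𝒳 S : SchemeOver ℂ}

/-! ## §1 (Prim)_t(r) read on the TOTAL SPACE: the fibre-primitive Hodge classes of `𝒳`, modulo `ker j_t^*` -/

/-- **(Prim)_t(r) ⟹ [every class of `span_ℂ Hdg^r(𝒳)` whose restriction to `X_t` is `κ`-primitive lies in
`N^r(𝒳) + ker j_t^*]**, at a fibre whose rational `(r,r)`-classes are algebraic (restriction preserves Hodge type, so the
restriction is algebraic, primitive and invariant). [cite: DeligneHodgeII1971, Cor. 4.1.2] [cite: Milne2020HodgeClassesAV, Prop. 1 (p. 7)] -/
theorem span_hodge_primitive_le_sup_of_primitiveLift_of_hodge {d : ℕ} {f : 𝒳 ⟶ S} (hf : IsCompactAbelianPencil f d)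
    (t : ComplexPoints S) (K : complexBetti 𝒳 2) {r : ℕ}
    (hHC : ∀ c : complexBetti (fiberOver f t) (2 * r), IsRationalClass c →
      IsOfHodgeType d (fiberOver f t) (2 * r) r r c → c ∈ algebraicClasses (fiberOver f t) r)
    (hPrim : ∀ ξ ∈ algebraicClasses (fiberOver f t) r,
      ξ ∈ primitiveClasses (complexBetti.map (fiberι f t) 2 K) d (2 * r) →
      ξ ∈ LinearMap.range (complexBetti.map (fiberι f t) (2 * r)).hom →
      ξ ∈ (algebraicClasses 𝒳 r).map (complexBetti.map (fiberι f t) (2 * r)).hom)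
    {W : complexBetti 𝒳 (2 * r)}
    (hW : W ∈ Submodule.span ℂ {c : complexBetti 𝒳 (2 * r) | IsRationalClass c ∧ IsOfHodgeType (d + 1) 𝒳 (2 * r) r r c})
    (hWprim : complexBetti.map (fiberι f t) (2 * r) W ∈ primitiveClasses (complexBetti.map (fiberι f t) 2 K) d (2 * r)) :
    W ∈ algebraicClasses 𝒳 r ⊔ LinearMap.ker (complexBetti.map (fiberι f t) (2 * r)).hom := by
  have h𝒳 := hf.isSmoothProjective_total
  have hXt := hf.isSmoothProjective_fiberOver t
  -- the restriction is algebraic on the fibre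
  have halg : complexBetti.map (fiberι f t) (2 * r) W ∈ algebraicClasses (fiberOver f t) r := by
    refine (Submodule.span_le (p := (algebraicClasses (fiberOver f t) r).comap
      (complexBetti.map (fiberι f t) (2 * r)).hom)).2 ?_ hW
    rintro c ⟨hcQ, hcH⟩
    exact hHC _ (hcQ.map (AlgPoints.mapContinuous (L := ℂ) (fiberι f t))) (hcH.map_of_isSmoothProjective hXt h𝒳 (fiberι f t))
  obtain ⟨a, ha, hja⟩ := Submodule.mem_map.1 (hPrim _ halg hWprim ⟨W, rfl⟩)
  rw [Submodule.mem_sup]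
  refine ⟨a, ha, W - a, ?_, add_sub_cancel a W⟩
  rw [LinearMap.mem_ker, map_sub, hja, sub_self]

/-- **[fibre-primitive classes of `span_ℂ Hdg^r(𝒳)` lie in `N^r(𝒳) + ker j_t^*] ⟹ (Prim)_t(r)**, on EVERY compact pencil at
EVERY point (no Hodge hypothesis): an invariant algebraic class of the fibre is `j_t^* W` with `W` in `span Hdg(𝒳) + ker j_t^*`
(part XVIII-f `comap_hodgeSpan_map_fiberι_eq_span_hodge_sup_ker`: Deligne's Hodge lift on the carriers).
[cite: DeligneHodgeII1971, Thm. 4.1.1 and Cor. 4.1.2] [cite: VoisinHodgeII2003, §4.3.1 Thm. 4.18] -/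
theorem primitiveLift_of_span_hodge_primitive_le_sup {d : ℕ} {f : 𝒳 ⟶ S} (hf : IsCompactAbelianPencil f d)
    (t : ComplexPoints S) (K : complexBetti 𝒳 2) {r : ℕ}
    (h : ∀ W ∈ Submodule.span ℂ {c : complexBetti 𝒳 (2 * r) | IsRationalClass c ∧ IsOfHodgeType (d + 1) 𝒳 (2 * r) r r c},
      complexBetti.map (fiberι f t) (2 * r) W ∈ primitiveClasses (complexBetti.map (fiberι f t) 2 K) d (2 * r) →
      W ∈ algebraicClasses 𝒳 r ⊔ LinearMap.ker (complexBetti.map (fiberι f t) (2 * r)).hom)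
    {ξ : complexBetti (fiberOver f t) (2 * r)} (hξ : ξ ∈ algebraicClasses (fiberOver f t) r)
    (hξprim : ξ ∈ primitiveClasses (complexBetti.map (fiberι f t) 2 K) d (2 * r))
    (hrange : ξ ∈ LinearMap.range (complexBetti.map (fiberι f t) (2 * r)).hom) :
    ξ ∈ (algebraicClasses 𝒳 r).map (complexBetti.map (fiberι f t) (2 * r)).hom := by
  have hXt := hf.isSmoothProjective_fiberOver t
  obtain ⟨W₀, hW₀⟩ := hrange
  -- `W₀ ∈ comap (span Hdg(X_t)) = span Hdg(𝒳) ⊔ ker j_t^*`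
  have hcomap : W₀ ∈ (Submodule.span ℂ {c : complexBetti (fiberOver f t) (2 * r) |
      IsRationalClass c ∧ IsOfHodgeType d (fiberOver f t) (2 * r) r r c}).comap
        (complexBetti.map (fiberι f t) (2 * r)).hom := by
    rw [Submodule.mem_comap, hW₀]
    exact algebraicClasses_le_span_hodgeClasses hXt r hξ
  rw [comap_hodgeSpan_map_fiberι_eq_span_hodge_sup_ker hf r t] at hcomap
  obtain ⟨W, hW, k, hk, hWk⟩ := Submodule.mem_sup.1 hcomap
  rw [LinearMap.mem_ker] at hk
  have hjW : complexBetti.map (fiberι f t) (2 * r) W = ξ := by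
    rw [← hW₀, ← hWk, map_add, hk, add_zero]
  obtain ⟨a, ha, k', hk', hak'⟩ := Submodule.mem_sup.1 (h W hW (by rw [hjW]; exact hξprim))
  rw [LinearMap.mem_ker] at hk'
  refine ⟨a, ha, ?_⟩
  rw [← hjW, ← hak', map_add, hk', add_zero]

/-- **AT A FIBRE SATISFYING `HC^r`: (Prim)_t(r) ⟺ [the fibre-PRIMITIVE classes of `span_ℂ Hdg^r(𝒳)` are algebraic modulo
`ker j_t^*`]** — the `B_min` class of record re-read as the Hodge conjecture for a finite-dimensional space of explicit Hodge
classes of the `(d+1)`-fold total space (those restricting to `κ`-primitive classes of the fibre; a basis suffices), modulo the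
classes dying on the fibre. (REFEREE-AB F-ab-94: `B_min` of record is F_CM, of which this bracket is a reading under `HC_CM`;
`span_ℂ Hdg^r(𝒳)` is a finite-dimensional space, not a finite set.)
[cite: DeligneHodgeII1971, Cor. 4.1.2] [cite: Milne2020HodgeClassesAV, Prop. 1 (p. 7)] [cite: Kleiman1968AlgebraicCycles, §3] -/
theorem primitiveLift_iff_span_hodge_primitive_le_sup_of_hodge {d : ℕ} {f : 𝒳 ⟶ S} (hf : IsCompactAbelianPencil f d)
    (t : ComplexPoints S) (K : complexBetti 𝒳 2) {r : ℕ}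
    (hHC : ∀ c : complexBetti (fiberOver f t) (2 * r), IsRationalClass c →
      IsOfHodgeType d (fiberOver f t) (2 * r) r r c → c ∈ algebraicClasses (fiberOver f t) r) :
    (∀ ξ ∈ algebraicClasses (fiberOver f t) r,
      ξ ∈ primitiveClasses (complexBetti.map (fiberι f t) 2 K) d (2 * r) →
      ξ ∈ LinearMap.range (complexBetti.map (fiberι f t) (2 * r)).hom →
      ξ ∈ (algebraicClasses 𝒳 r).map (complexBetti.map (fiberι f t) (2 * r)).hom) ↔
    ∀ W ∈ Submodule.span ℂ {c : complexBetti 𝒳 (2 * r) | IsRationalClass c ∧ IsOfHodgeType (d + 1) 𝒳 (2 * r) r r c},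
      complexBetti.map (fiberι f t) (2 * r) W ∈ primitiveClasses (complexBetti.map (fiberι f t) 2 K) d (2 * r) →
      W ∈ algebraicClasses 𝒳 r ⊔ LinearMap.ker (complexBetti.map (fiberι f t) (2 * r)).hom :=
  ⟨fun h _ hW hWprim ↦ span_hodge_primitive_le_sup_of_primitiveLift_of_hodge hf t K hHC h hW hWprim,
    fun h _ hξ hξprim hrange ↦ primitiveLift_of_span_hodge_primitive_le_sup hf t K h hξ hξprim hrange⟩

/-- **AT A CM POINT UNDER `HC_CM` (a BINDER): (Prim)_t(r) ⟺ [fibre-primitive Hodge classes of `𝒳` algebraic mod `ker j_t^*`].**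
[cite: Andre1996Motifs, §6.3 a) (p. 33)] [cite: DeligneHodgeII1971, Cor. 4.1.2] -/
theorem primitiveLift_iff_span_hodge_primitive_le_sup_of_HC_CM (hCM : RankFourFaces.CMAbelianHodge) {d : ℕ}
    {f : 𝒳 ⟶ S} (hf : IsCompactAbelianPencil f d) {t : ComplexPoints S} (ht : t ∈ cmLocus f d)
    (K : complexBetti 𝒳 2) {r : ℕ} :
    (∀ ξ ∈ algebraicClasses (fiberOver f t) r,
      ξ ∈ primitiveClasses (complexBetti.map (fiberι f t) 2 K) d (2 * r) →
      ξ ∈ LinearMap.range (complexBetti.map (fiberι f t) (2 * r)).hom →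
      ξ ∈ (algebraicClasses 𝒳 r).map (complexBetti.map (fiberι f t) (2 * r)).hom) ↔
    ∀ W ∈ Submodule.span ℂ {c : complexBetti 𝒳 (2 * r) | IsRationalClass c ∧ IsOfHodgeType (d + 1) 𝒳 (2 * r) r r c},
      complexBetti.map (fiberι f t) (2 * r) W ∈ primitiveClasses (complexBetti.map (fiberι f t) 2 K) d (2 * r) →
      W ∈ algebraicClasses 𝒳 r ⊔ LinearMap.ker (complexBetti.map (fiberι f t) (2 * r)).hom := by
  obtain ⟨A₀, ⟨e₀⟩, hdim, hcm⟩ := ht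
  exact primitiveLift_iff_span_hodge_primitive_le_sup_of_hodge hf t K
    fun c hc hcpp ↦ Ring2Transport.mem_algebraicClasses_of_cmChart hCM A₀ e₀ hdim hcm hc hcpp

/-! ## §2 `d = 4` and the node level in the total-space language -/

/-- **`d = 4`, AT A CM POINT UNDER `HC_CM`: (Num_t)(2,2) ⟺ [every class of `span_ℂ Hdg²(𝒳)` on the FIVEFOLD `𝒳` whose restriction
to the CM abelian fourfold `X_t` is `κ`-primitive is algebraic modulo `ker j_t^*`]** — the smallest kernel-open instance of `Num^CM`
as the Hodge conjecture for the fibre-primitive rational `(2,2)`-classes of one fivefold, modulo the classes dying on the fibre.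
[cite: Andre1996Motifs, §6.3 a) (p. 33)] [cite: Kleiman1968AlgebraicCycles, §3 (D(X))] [cite: DeligneHodgeII1971, Cor. 4.1.2] -/
theorem numerical_two_two_iff_span_hodge_primitive_le_sup_of_HC_CM (hCM : RankFourFaces.CMAbelianHodge) {f : 𝒳 ⟶ S}
    (hf : IsCompactAbelianPencil f 4) {t : ComplexPoints S} (ht : t ∈ cmLocus f 4) {K : complexBetti 𝒳 2}
    (hKalg : K ∈ algebraicClasses 𝒳 1)
    (hK : ∀ s : ComplexPoints S, HasHardLefschetzProperty (complexBetti.map (fiberι f s) 2 K) 4)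
    (hKt : IsPolarizationClass 4 (fiberOver f t) (complexBetti.map (fiberι f t) 2 K)) :
    (∀ b ∈ algebraicClasses (fiberOver f t) 2,
      (∀ a ∈ algebraicClasses 𝒳 2,
        cupProduct (show 2 * 2 + 2 * (2 + 1) = 2 * (4 + 1) by omega) a (fiberGysin hf t 2 b) = 0) →
        fiberGysin hf t 2 b = 0) ↔
    ∀ W ∈ Submodule.span ℂ {c : complexBetti 𝒳 (2 * 2) | IsRationalClass c ∧ IsOfHodgeType (4 + 1) 𝒳 (2 * 2) 2 2 c},
      complexBetti.map (fiberι f t) (2 * 2) W ∈ primitiveClasses (complexBetti.map (fiberι f t) 2 K) 4 (2 * 2) →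
      W ∈ algebraicClasses 𝒳 2 ⊔ LinearMap.ker (complexBetti.map (fiberι f t) (2 * 2)).hom :=
  (numerical_two_two_iff_primitiveLift_two_of_HC_CM hCM hf ht hKalg hK hKt).trans
    (primitiveLift_iff_span_hodge_primitive_le_sup_of_HC_CM hCM hf ht K)

/-- Display-only shape (no `def`): **the fibre-primitive Hodge classes of the total spaces of CM-pointed compact abelian pencils
are algebraic modulo the classes dying on the CM fibre** (`2 ≤ r`, `2r ≤ d`, every global algebraic polarising class `K`). -/
local notation3 (prettyPrint := false) "CMPrimitiveHodgeTotal[]" =>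
  ∀ ⦃d : ℕ⦄ ⦃𝒳 S : SchemeOver ℂ⦄ (f : 𝒳 ⟶ S) (_ : IsCompactAbelianPencil f d) (t : ComplexPoints S),
    t ∈ cmLocus f d → ∀ (K : complexBetti 𝒳 2), K ∈ algebraicClasses 𝒳 1 →
    (∀ s : ComplexPoints S, IsPolarizationClass d (fiberOver f s) (complexBetti.map (fiberι f s) 2 K)) →
    ∀ r, 2 ≤ r → 2 * r ≤ d →
    ∀ W ∈ Submodule.span ℂ {c : complexBetti 𝒳 (2 * r) | IsRationalClass c ∧ IsOfHodgeType (d + 1) 𝒳 (2 * r) r r c},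
      complexBetti.map (fiberι f t) (2 * r) W ∈ primitiveClasses (complexBetti.map (fiberι f t) 2 K) d (2 * r) →
      W ∈ algebraicClasses 𝒳 r ⊔ LinearMap.ker (complexBetti.map (fiberι f t) (2 * r)).hom

/-- Display-only shape (as in parts XXI-b/c; no `def`): the CM PRIMITIVE LIFT. -/
local notation3 (prettyPrint := false) "CMPrimitiveLift[]" =>
  ∀ ⦃d : ℕ⦄ ⦃𝒳 S : SchemeOver ℂ⦄ (f : 𝒳 ⟶ S) (_ : IsCompactAbelianPencil f d) (t : ComplexPoints S),
    t ∈ cmLocus f d → ∀ (K : complexBetti 𝒳 2), K ∈ algebraicClasses 𝒳 1 →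
    (∀ s : ComplexPoints S, IsPolarizationClass d (fiberOver f s) (complexBetti.map (fiberι f s) 2 K)) →
    ∀ r, 2 ≤ r → 2 * r ≤ d → ∀ ξ ∈ algebraicClasses (fiberOver f t) r,
      ξ ∈ primitiveClasses (complexBetti.map (fiberι f t) 2 K) d (2 * r) →
      ξ ∈ LinearMap.range (complexBetti.map (fiberι f t) (2 * r)).hom →
      ξ ∈ (algebraicClasses 𝒳 r).map (complexBetti.map (fiberι f t) (2 * r)).hom

/-- **[fibre-primitive Hodge classes of the total spaces algebraic mod ker] ⟹ [CM primitive lift]** — fact-free, `HC_CM`-free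
(§1, second theorem). [cite: DeligneHodgeII1971, Cor. 4.1.2] -/
theorem cmPrimitiveLift_of_cmPrimitiveHodgeTotal (h : CMPrimitiveHodgeTotal[]) : CMPrimitiveLift[] :=
  fun _ _ _ f hf t ht K hKalg hKs r h2 h2d _ hξ hξprim hrange ↦
    primitiveLift_of_span_hodge_primitive_le_sup hf t K (h f hf t ht K hKalg hKs r h2 h2d) hξ hξprim hrange

/-- **`HC_CM ⊢ [CM primitive lift] ⟺ [fibre-primitive Hodge classes of the total spaces algebraic mod ker]`** (`HC_CM` a BINDER,
needed for `⟹` only). [cite: Andre1996Motifs, §6.3 a) (p. 33)] [cite: DeligneHodgeII1971, Cor. 4.1.2] -/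
theorem cmPrimitiveLift_iff_cmPrimitiveHodgeTotal_of_HC_CM (hCM : RankFourFaces.CMAbelianHodge) :
    CMPrimitiveLift[] ↔ CMPrimitiveHodgeTotal[] :=
  ⟨fun h _ _ _ f hf t ht K hKalg hKs r h2 h2d _ hW hWprim ↦
      (primitiveLift_iff_span_hodge_primitive_le_sup_of_HC_CM hCM hf ht K).1 (h f hf t ht K hKalg hKs r h2 h2d) _ hW hWprim,
    cmPrimitiveLift_of_cmPrimitiveHodgeTotal⟩

/-- **`HC_CM ⊢ (L) ⟺ Num^CM ⟺ [CM primitive lift] ⟺ [fibre-primitive Hodge classes of the total spaces algebraic mod ker]`**: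
the (L)-node in the total-space language (part XVIII-f had "(L) ⟺ ALL Hodge classes of the total space algebraic mod ker";
the primitive reading keeps only the fibre-primitive ones). [cite: Andre1996Motifs, §6.3 (p. 33)] [cite: Kleiman1968AlgebraicCycles, §3] -/
theorem cmFibreAlgebraicLift_iff_cmPrimitiveHodgeTotal_of_HC_CM (hCM : RankFourFaces.CMAbelianHodge) :
    CMFibreAlgebraicLift ↔ CMPrimitiveHodgeTotal[] :=
  (cmFibreAlgebraicLift_iff_cmPrimitiveLift_of_HC_CM hCM).trans (cmPrimitiveLift_iff_cmPrimitiveHodgeTotal_of_HC_CM hCM)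

/-- **THE CELL ROW IN THE TOTAL-SPACE LANGUAGE: `h₂₁ → HC_CM → [fibre-primitive Hodge classes of the total spaces of CM-pointed
compact abelian pencils algebraic modulo the classes dying on the CM fibre] → HC_AV`** (`HC_CM`, `h₂₁` BINDERS). The bracket is a
list of instances of the Hodge conjecture on explicit `(d+1)`-folds (finitely many classes per pencil and degree), weakened by
"modulo `ker j_t^*`". research route, not a corollary; conditional on HC_CM plus one named minimal statement.
[cite: Andre1996Motifs, Lemme 6.3.1 (p. 31) and §6.3 (p. 33)] [cite: Milne2020HodgeClassesAV, Prop. 1 (p. 7)] -/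
theorem HC_AV_of_HC_CM_of_cmPrimitiveHodgeTotal (h₂₁ : andre1996_cmAnchoredPencil) (hCM : RankFourFaces.CMAbelianHodge)
    (h : CMPrimitiveHodgeTotal[]) : PadicSemiregularLift.HodgeAbelianVarieties :=
  HC_AV_of_HC_CM_of_cmPrimitiveLift h₂₁ hCM (cmPrimitiveLift_of_cmPrimitiveHodgeTotal h)

/-- **ON-PATH: `HodgeConjecture ⟹ [fibre-primitive Hodge classes of the total spaces algebraic mod ker]`** (indeed with no
"mod ker": every class of `span Hdg^r(𝒳)` is algebraic under the Hodge conjecture for the smooth projective `(d+1)`-fold `𝒳`).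
[cite: Andre1996Motifs, §6.3 (p. 33)] -/
theorem cmPrimitiveHodgeTotal_of_hodgeConjecture (hHC : _root_.HodgeConjecture) : CMPrimitiveHodgeTotal[] := by
  intro d 𝒳 S f hf t _ K _ _ r _ _ W hW _
  refine Submodule.mem_sup_left ?_
  refine (Submodule.span_le (p := algebraicClasses 𝒳 r)).2 ?_ hW
  rintro c ⟨hcQ, hcH⟩
  exact (hHC hf.isSmoothProjective_total).2 r c hcQ hcH

/-- **EXACTNESS modulo [h₂₁, Verdier]: `HC_AV ⟺ HC_CM ∧ [fibre-primitive Hodge classes of the total spaces algebraic mod ker]`.**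
[cite: Andre1996Motifs, Lemme 6.3.1 (p. 31)] [cite: Verdier1976, Cor. (5.1)] -/
theorem HC_AV_iff_HC_CM_and_cmPrimitiveHodgeTotal_of_verdier (h₂₁ : andre1996_cmAnchoredPencil)
    (hGT : Verdier1976_genericLocalTriviality) :
    PadicSemiregularLift.HodgeAbelianVarieties ↔ (RankFourFaces.CMAbelianHodge ∧ CMPrimitiveHodgeTotal[]) := by
  rw [HC_AV_iff_HC_CM_and_cmPrimitiveLift_of_verdier h₂₁ hGT]
  exact ⟨fun h ↦ ⟨h.1, (cmPrimitiveLift_iff_cmPrimitiveHodgeTotal_of_HC_CM h.1).1 h.2⟩,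
    fun h ↦ ⟨h.1, cmPrimitiveLift_of_cmPrimitiveHodgeTotal h.2⟩⟩

end Summit.HodgeConjecture.HodgeConjecture.Ring2.AbelianAll

end
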